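import Literature.NumberTheory.LFunctions.GaussianCosetThetaFE
import Literature.NumberTheory.LFunctions.GaussianHeckeThetaMellin
import Mathlib.NumberTheory.LSeries.AbstractFuncEq
import Mathlib.NumberTheory.LSeries.MellinEqDirichlet
import HarnessLib

/-!
# Coset zeta functions of `ℤ[i]` with Grössencharakter `z^k`: continuation via the coset theta series

Topic `Literature/NumberTheory/LFunctions`, sequel to `GaussianCosetThetaFE.lean` (coset theta series
`Θ_k(t; c, M) = ∑_{z ≡ c (M)} z^k e^{-πtN(z)/M}`, dual series `Θ̂_k`, and the transformation formula
`Θ_k(1/x; c, M) = (-i)^k M⁻¹ x^{k+1} Θ̂_k(x; c, M)`), after the model `GaussianHeckeThetaMellin.lean`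
(the case `M = 1`). Everything is PROVED; no named facts.

For `M ≥ 1`, `c ∈ ℤ[i]`, `k : ℕ` consider the Dirichlet series over the coset

  `Z_k(s; c, M) = ∑_{z ≡ c (mod M), z ≠ 0} z^k N(z)^{-s}`      (`Re s > k/2 + 1`),

the building block of the Hecke `L`-functions `L(s, ψ) = ∑_{z primary} χ(z) (z/|z|)^k N(z)^{-s}
= ∑_{c} χ(c) Z_k(s + k/2; c, M)` of `ℚ(i)` (`χ` a character of `(ℤ[i]/Mℤ[i])ˣ`, `4 ∣ M`; Hecke 1920
§9; Friedlander–Iwaniec 1998 §16 (16.16)–(16.17)).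

* `cosetPair M c k` — Mathlib's `WeakFEPair` packaging: `f = Θ_k(·; c, M)`, `g = Θ̂_k(·; c, M)`,
  weight `k + 1`, root number `(-i)^k/M`, constant terms `f₀ = Θ₀ = [k = 0][0 ∈ c + Mℤ[i]]`
  (`theta₀`), `g₀ = [k = 0]` (`dualTheta₀`); exponential decay `Θ_k - Θ₀ = O(e^{-πt/M})`
  (`isBigO_theta_sub`, `isBigO_dualTheta_sub`) and continuity on `(0, ∞)`; strong for `k ≥ 1`
  (`isStrongFEPair_cosetPair`);
* `cosetZeta M c k s = (π/M)^s Γ(s)⁻¹ Λ(s)` — the continuation of `Z_k(s; c, M)`: **entire for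
  `k ≥ 1`** (`differentiable_cosetZeta`), holomorphic off `s = 0, 1` for `k = 0`
  (`differentiableAt_cosetZeta`), and **equal to the Dirichlet series for `Re s > k/2 + 1`**
  (`hasSum_cosetZeta`; Mellin transform `hasSum_mellin_theta_sub`, Mathlib's `hasSum_mellin_pi_mul₀`);
* for `k = 0`: `cosetZetaH M c s = (s - 1) Z_0(s; c, M)` written through the entire `Λ₀`,
  holomorphic at every `s ≠ 0` with **`cosetZetaH M c 1 = π/M²`** (`cosetZetaH_one`,
  `cosetZetaH_eq`): `Z_0(·; c, M)` has a simple pole at `s = 1` with residue `π/M²` (density of the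
  coset times the area factor), INDEPENDENT of `c` — so `∑_c χ(c) Z_0(s; c, M)` is entire as soon
  as `∑_c χ(c) = 0`.

The functional equation relating `Λ` to the completed Mellin transform of `Θ̂_k(·; c, M)`
(`(cosetPair M c k).symm`) is Mathlib's `WeakFEPair.functional_equation`; the growth estimates in
vertical strips are in the sequel.

## References

* E. Hecke, *Eine neue Art von Zetafunktionen und ihre Beziehungen zur Verteilung der
  Primzahlen. II*, Math. Z. 6 (1920), 11–51, §9. [HeckeMathZ1920]
* J. Friedlander, H. Iwaniec, *The polynomial `X² + Y⁴` captures its primes*, Ann. of Math. (2)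
  148 (1998), 945–1040, §16 (16.16)–(16.17) ("This has a meromorphic continuation to `ℂ`, is entire
  apart from a simple pole at `s = 1` in case of trivial `ψ`"). [FriedlanderIwaniecAnnals1998]

## Mathlib / tree

Mathlib: `WeakFEPair` (`Λ`, `Λ₀`, `hasMellin`, `differentiable_Λ`, `differentiableAt_Λ`,
`differentiable_Λ₀`), `hasSum_mellin_pi_mul₀`, `continuousOn_tsum`,
`isLittleO_exp_neg_mul_rpow_atTop`, `Complex.differentiable_one_div_Gamma`,
`Complex.mul_cpow_ofReal_nonneg`, `Complex.inv_cpow`. Tree: `GaussianCosetTheta.theta_one_div`,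
`hasSum_theta`, `hasSum_dualTheta`, `summable_norm_thetaTerm`, `pt_injective`, `norm_addChar`
(`GaussianCosetThetaFE`); `GaussianHecke.summable_norm_pow_div_rpow`, `norm_ofReal_exp`
(`GaussianHeckeThetaMellin`, `GaussianHeckeThetaFE`).
-/

noncomputable section

open Complex Real Filter Topology Asymptotics Set MeasureTheory
open scoped Nat

namespace Literature.NumberTheory.LFunctions

namespace GaussianCosetTheta

local notation "ℤ[i]" => GaussianInt

open GaussianHecke (norm_cast_real norm_ofReal_exp)

variable {M : ℕ} [NeZero M] {c : ℤ[i]}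

open Set Asymptotics MeasureTheory

/-! ### Norms of the summands; continuity on `(0, ∞)` -/

omit [NeZero M] in
/-- `‖z^k e^{-π t N(z)/M}‖ = |z|^k e^{-π t N(z)/M}`, `z = c + M y`. [folklore] -/
theorem norm_thetaTerm (k : ℕ) (t : ℝ) (y : ℤ[i]) :
    ‖thetaTerm M c k t y‖ = ‖((pt M c y : ℤ[i]) : ℂ)‖ ^ k * rexp (-π * t * ((pt M c y).norm : ℝ) / M) := by
  rw [thetaTerm, norm_mul, norm_ofReal_exp, norm_pow]

omit [NeZero M] in
/-- `‖e(Re(y c̄)/M) y^k e^{-π u N(y)/M}‖ = |y|^k e^{-π u N(y)/M}`. [folklore] -/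
theorem norm_dualThetaTerm (k : ℕ) (u : ℝ) (y : ℤ[i]) :
    ‖dualThetaTerm M c k u y‖ = ‖(y : ℂ)‖ ^ k * rexp (-π * u * (y.norm : ℝ) / M) := by
  rw [dualThetaTerm, norm_mul, norm_addChar, one_mul, norm_mul, norm_ofReal_exp, norm_pow]

/-- Monotonicity in `t` of the theta summands. [folklore] -/
theorem norm_thetaTerm_mono (k : ℕ) {a t : ℝ} (hat : a ≤ t) (y : ℤ[i]) :
    ‖thetaTerm M c k t y‖ ≤ ‖thetaTerm M c k a y‖ := by
  rw [norm_thetaTerm, norm_thetaTerm]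
  have hN : (0 : ℝ) ≤ ((pt M c y).norm : ℝ) := by exact_mod_cast GaussianInt.norm_nonneg _
  refine mul_le_mul_of_nonneg_left (Real.exp_le_exp.mpr ?_) (pow_nonneg (norm_nonneg _) _)
  rw [div_le_div_iff_of_pos_right (M_pos M)]
  nlinarith [mul_nonneg (mul_nonneg pi_pos.le (sub_nonneg.mpr hat)) hN]

/-- Monotonicity in `u` of the dual theta summands. [folklore] -/
theorem norm_dualThetaTerm_mono (k : ℕ) {a u : ℝ} (hau : a ≤ u) (y : ℤ[i]) :
    ‖dualThetaTerm M c k u y‖ ≤ ‖dualThetaTerm M c k a y‖ := by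
  rw [norm_dualThetaTerm, norm_dualThetaTerm]
  have hN : (0 : ℝ) ≤ (y.norm : ℝ) := by exact_mod_cast GaussianInt.norm_nonneg _
  refine mul_le_mul_of_nonneg_left (Real.exp_le_exp.mpr ?_) (pow_nonneg (norm_nonneg _) _)
  rw [div_le_div_iff_of_pos_right (M_pos M)]
  nlinarith [mul_nonneg (mul_nonneg pi_pos.le (sub_nonneg.mpr hau)) hN]

/-- `Θ_k(·; c, M)` is continuous on `(0, ∞)` (locally uniform convergence). [folklore] -/
theorem continuousOn_theta (k : ℕ) : ContinuousOn (theta M c k) (Ioi 0) := by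
  refine continuousOn_of_forall_continuousAt fun t₀ ht₀ ↦ ?_
  have ht₀' : (0 : ℝ) < t₀ := ht₀
  have ha : 0 < t₀ / 2 := half_pos ht₀'
  have hcont : ContinuousOn (theta M c k) (Ici (t₀ / 2)) := by
    refine continuousOn_tsum (f := fun y t ↦ thetaTerm M c k t y) (fun y ↦ ?_)
      (summable_norm_thetaTerm k ha) (fun y t ht ↦ norm_thetaTerm_mono k ht y)
    exact Continuous.continuousOn (by unfold thetaTerm; fun_prop)
  exact hcont.continuousAt (Ici_mem_nhds (by linarith))

/-- `Θ̂_k(·; c, M)` is continuous on `(0, ∞)`. [folklore] -/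
theorem continuousOn_dualTheta (k : ℕ) : ContinuousOn (dualTheta M c k) (Ioi 0) := by
  refine continuousOn_of_forall_continuousAt fun t₀ ht₀ ↦ ?_
  have ht₀' : (0 : ℝ) < t₀ := ht₀
  have ha : 0 < t₀ / 2 := half_pos ht₀'
  have hcont : ContinuousOn (dualTheta M c k) (Ici (t₀ / 2)) := by
    refine continuousOn_tsum (f := fun y t ↦ dualThetaTerm M c k t y) (fun y ↦ ?_)
      (summable_norm_dualThetaTerm k ha) (fun y t ht ↦ norm_dualThetaTerm_mono k ht y)
    exact Continuous.continuousOn (by unfold dualThetaTerm addChar; fun_prop)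
  exact hcont.continuousAt (Ici_mem_nhds (by linarith))

/-! ### The constant terms and the exponential decay at `∞` -/

variable (M c)

open scoped Classical in
/-- The constant term of `Θ_k(·; c, M)` at `∞`: the contribution of `z = 0`, present iff `k = 0`
and `0 ∈ c + Mℤ[i]`. [folklore] -/
def theta₀ (k : ℕ) : ℂ := if k = 0 ∧ (M : ℤ[i]) ∣ c then 1 else 0

/-- The constant term of `Θ̂_k(·; c, M)` at `∞`: the term `y = 0`, equal to `[k = 0]`. [folklore] -/
def dualTheta₀ (k : ℕ) : ℂ := if k = 0 then 1 else 0

variable {M c}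

omit [NeZero M] in
/-- The theta summand at a point with `c + M y = 0` is `[k = 0]`. [folklore] -/
theorem thetaTerm_of_pt_eq_zero (k : ℕ) (t : ℝ) {y : ℤ[i]} (hy : pt M c y = 0) :
    thetaTerm M c k t y = if k = 0 then 1 else 0 := by
  rw [thetaTerm, hy, map_zero, Zsqrtd.norm_zero, Int.cast_zero, mul_zero, zero_div, Real.exp_zero,
    ofReal_one, mul_one]
  rcases Nat.eq_zero_or_pos k with rfl | hk
  · simp
  · rw [zero_pow hk.ne', if_neg hk.ne']

omit [NeZero M] in
/-- The dual summand at `y = 0` is `[k = 0]`. [folklore] -/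
theorem dualThetaTerm_zero (k : ℕ) (u : ℝ) : dualThetaTerm M c k u 0 = if k = 0 then 1 else 0 := by
  rw [dualThetaTerm, addChar, zero_mul, Zsqrtd.re_zero, Int.cast_zero, mul_zero, zero_div,
    Complex.exp_zero, one_mul, map_zero, Zsqrtd.norm_zero, Int.cast_zero, mul_zero, zero_div,
    Real.exp_zero, ofReal_one, mul_one]
  rcases Nat.eq_zero_or_pos k with rfl | hk
  · simp
  · rw [zero_pow hk.ne', if_neg hk.ne']

open scoped Classical in
/-- The part of the theta series supported on `z = 0` sums to `theta₀`. [folklore] -/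
theorem hasSum_thetaTerm_zeroPart (k : ℕ) (t : ℝ) :
    HasSum (fun y : ℤ[i] ↦ if pt M c y = 0 then thetaTerm M c k t y else 0) (theta₀ M c k) := by
  by_cases hc : (M : ℤ[i]) ∣ c
  · obtain ⟨d, hd⟩ := hc
    have hpt : ∀ y : ℤ[i], pt M c y = 0 ↔ y = -d := by
      intro y
      constructor
      · intro h
        have h1 : pt M c y = pt M c (-d) := by rw [h, pt, hd]; ring
        exact pt_injective M c h1
      · rintro rfl
        rw [pt, hd]; ring
    have h0 : pt M c (-d) = 0 := (hpt _).mpr rfl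
    have hval : theta₀ M c k = thetaTerm M c k t (-d) := by
      rw [thetaTerm_of_pt_eq_zero k t h0, theta₀]
      by_cases hk : k = 0
      · rw [if_pos ⟨hk, d, hd⟩, if_pos hk]
      · rw [if_neg (fun h ↦ hk h.1), if_neg hk]
    rw [hval]
    convert hasSum_ite_eq (-d) (thetaTerm M c k t (-d)) using 1
    funext y
    by_cases hy : y = -d
    · subst hy; simp [h0]
    · rw [if_neg ((hpt y).not.mpr hy), if_neg hy]
  · have hval : theta₀ M c k = 0 := by
      rw [theta₀, if_neg (fun h ↦ hc h.2)]
    have hne : ∀ y : ℤ[i], pt M c y ≠ 0 := by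
      intro y h
      exact hc ⟨-y, by rw [pt] at h; linear_combination h⟩
    rw [hval]
    convert hasSum_zero (α := ℂ) (β := ℤ[i]) using 1
    funext y
    rw [if_neg (hne y)]

/-- For `t ≥ 1` and `z = c + M y ≠ 0`: `‖z^k e^{-πtN(z)/M}‖ ≤ e^{-π(t-1)/M} ‖z^k e^{-πN(z)/M}‖`
(`N(z) ≥ 1`). [folklore] -/
theorem norm_thetaTerm_le_exp_mul (k : ℕ) {t : ℝ} (ht : 1 ≤ t) {y : ℤ[i]} (hy : pt M c y ≠ 0) :
    ‖thetaTerm M c k t y‖ ≤ rexp (-π * (t - 1) / M) * ‖thetaTerm M c k 1 y‖ := by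
  rw [norm_thetaTerm, norm_thetaTerm, mul_left_comm, ← Real.exp_add]
  have hN : (1 : ℝ) ≤ ((pt M c y).norm : ℝ) := by
    have h1 : (1 : ℤ) ≤ (pt M c y).norm := by have := GaussianInt.norm_pos.mpr hy; omega
    exact_mod_cast h1
  refine mul_le_mul_of_nonneg_left (Real.exp_le_exp.mpr ?_) (pow_nonneg (norm_nonneg _) _)
  rw [← add_div, mul_one, div_le_div_iff_of_pos_right (M_pos M)]
  nlinarith [mul_nonneg (mul_nonneg pi_pos.le (sub_nonneg.mpr ht)) (sub_nonneg.mpr hN)]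

/-- For `u ≥ 1` and `y ≠ 0`: the dual summand at `u` is `≤ e^{-π(u-1)/M}` times the one at `1`.
[folklore] -/
theorem norm_dualThetaTerm_le_exp_mul (k : ℕ) {u : ℝ} (hu : 1 ≤ u) {y : ℤ[i]} (hy : y ≠ 0) :
    ‖dualThetaTerm M c k u y‖ ≤ rexp (-π * (u - 1) / M) * ‖dualThetaTerm M c k 1 y‖ := by
  rw [norm_dualThetaTerm, norm_dualThetaTerm, mul_left_comm, ← Real.exp_add]
  have hN : (1 : ℝ) ≤ (y.norm : ℝ) := by
    have h1 : (1 : ℤ) ≤ y.norm := by have := GaussianInt.norm_pos.mpr hy; omega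
    exact_mod_cast h1
  refine mul_le_mul_of_nonneg_left (Real.exp_le_exp.mpr ?_) (pow_nonneg (norm_nonneg _) _)
  rw [← add_div, mul_one, div_le_div_iff_of_pos_right (M_pos M)]
  nlinarith [mul_nonneg (mul_nonneg pi_pos.le (sub_nonneg.mpr hu)) (sub_nonneg.mpr hN)]

open scoped Classical in
/-- `‖Θ_k(t; c, M) - Θ₀‖ ≤ e^{-π(t-1)/M} ∑_y ‖thetaTerm 1 y‖` for `t ≥ 1`. [folklore] -/
theorem norm_theta_sub_le (k : ℕ) {t : ℝ} (ht : 1 ≤ t) :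
    ‖theta M c k t - theta₀ M c k‖ ≤ rexp (-π * (t - 1) / M) * ∑' y : ℤ[i], ‖thetaTerm M c k 1 y‖ := by
  have ht0 : 0 < t := by linarith
  have h1 : HasSum (fun y : ℤ[i] ↦ thetaTerm M c k t y - if pt M c y = 0 then thetaTerm M c k t y else 0)
      (theta M c k t - theta₀ M c k) := (hasSum_theta k ht0).sub (hasSum_thetaTerm_zeroPart k t)
  rw [← h1.tsum_eq]
  have hb := ((summable_norm_thetaTerm (M := M) (c := c) k one_pos).mul_left
    (rexp (-π * (t - 1) / M))).hasSum
  rw [← tsum_mul_left]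
  refine tsum_of_norm_bounded hb fun y ↦ ?_
  by_cases hy : pt M c y = 0
  · rw [if_pos hy, sub_self, norm_zero]
    positivity
  · rw [if_neg hy, sub_zero]
    exact norm_thetaTerm_le_exp_mul k ht hy

/-- `‖Θ̂_k(u; c, M) - [k=0]‖ ≤ e^{-π(u-1)/M} ∑_y ‖dualThetaTerm 1 y‖` for `u ≥ 1`. [folklore] -/
theorem norm_dualTheta_sub_le (k : ℕ) {u : ℝ} (hu : 1 ≤ u) :
    ‖dualTheta M c k u - dualTheta₀ k‖ ≤
      rexp (-π * (u - 1) / M) * ∑' y : ℤ[i], ‖dualThetaTerm M c k 1 y‖ := by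
  have hu0 : 0 < u := by linarith
  have h1 : HasSum (fun y : ℤ[i] ↦ dualThetaTerm M c k u y - if y = 0 then dualThetaTerm M c k u 0 else 0)
      (dualTheta M c k u - dualThetaTerm M c k u 0) := (hasSum_dualTheta k hu0).sub (hasSum_ite_eq 0 _)
  rw [dualTheta₀, ← dualThetaTerm_zero (M := M) (c := c) k u, ← h1.tsum_eq]
  have hb := ((summable_norm_dualThetaTerm (M := M) (c := c) k one_pos).mul_left
    (rexp (-π * (u - 1) / M))).hasSum
  rw [← tsum_mul_left]
  refine tsum_of_norm_bounded hb fun y ↦ ?_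
  by_cases hy : y = 0
  · subst hy
    rw [if_pos rfl, sub_self, norm_zero]
    positivity
  · rw [if_neg hy, sub_zero]
    exact norm_dualThetaTerm_le_exp_mul k hu hy

/-- **`Θ_k(t; c, M) - Θ₀ = O(t^r)` at `∞` for every `r`** (indeed `O(e^{-πt/M})`). [folklore] -/
theorem isBigO_theta_sub (k : ℕ) (r : ℝ) :
    (fun t ↦ theta M c k t - theta₀ M c k) =O[atTop] fun t ↦ t ^ r := by
  have hM := M_pos M
  have h1 : (fun t ↦ theta M c k t - theta₀ M c k) =O[atTop] fun t ↦ rexp (-(π / M) * t) := by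
    refine IsBigO.of_bound (rexp (π / M) * ∑' y : ℤ[i], ‖thetaTerm M c k 1 y‖) ?_
    filter_upwards [eventually_ge_atTop 1] with t ht
    refine (norm_theta_sub_le k ht).trans (le_of_eq ?_)
    rw [Real.norm_of_nonneg (Real.exp_pos _).le,
      show -π * (t - 1) / M = -(π / M) * t + π / M by field_simp; ring, Real.exp_add]
    ring
  exact h1.trans (isLittleO_exp_neg_mul_rpow_atTop (div_pos pi_pos hM) r).isBigO

/-- **`Θ̂_k(u; c, M) - [k=0] = O(u^r)` at `∞` for every `r`.** [folklore] -/
theorem isBigO_dualTheta_sub (k : ℕ) (r : ℝ) :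
    (fun u ↦ dualTheta M c k u - dualTheta₀ k) =O[atTop] fun u ↦ u ^ r := by
  have hM := M_pos M
  have h1 : (fun u ↦ dualTheta M c k u - dualTheta₀ k) =O[atTop] fun u ↦ rexp (-(π / M) * u) := by
    refine IsBigO.of_bound (rexp (π / M) * ∑' y : ℤ[i], ‖dualThetaTerm M c k 1 y‖) ?_
    filter_upwards [eventually_ge_atTop 1] with u hu
    refine (norm_dualTheta_sub_le k hu).trans (le_of_eq ?_)
    rw [Real.norm_of_nonneg (Real.exp_pos _).le,
      show -π * (u - 1) / M = -(π / M) * u + π / M by field_simp; ring, Real.exp_add]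
    ring
  exact h1.trans (isLittleO_exp_neg_mul_rpow_atTop (div_pos pi_pos hM) r).isBigO

/-! ### The FE-pair of a coset and the continued coset zeta function -/

variable (M c)

/-- The coset theta series as a weak FE-pair (Mathlib `WeakFEPair`): `f = Θ_k(·; c, M)`,
`g = Θ̂_k(·; c, M)`, weight `k + 1`, root number `(-i)^k / M`, constant terms `Θ₀`, `[k = 0]`;
the functional equation is `theta_one_div`. [folklore] -/
def cosetPair (k : ℕ) : WeakFEPair ℂ where
  f := theta M c k
  g := dualTheta M c k
  k := k + 1
  ε := (-I) ^ k * ((M : ℂ))⁻¹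
  f₀ := theta₀ M c k
  g₀ := dualTheta₀ k
  hf_int := (continuousOn_theta k).locallyIntegrableOn measurableSet_Ioi
  hg_int := (continuousOn_dualTheta k).locallyIntegrableOn measurableSet_Ioi
  hk := by positivity
  hε := mul_ne_zero (pow_ne_zero _ (neg_ne_zero.mpr I_ne_zero))
    (inv_ne_zero (by exact_mod_cast NeZero.ne M))
  h_feq := fun x hx ↦ by
    rw [theta_one_div k hx, smul_eq_mul]
    rw [show ((k : ℝ) + 1) = ((k + 1 : ℕ) : ℝ) by push_cast; ring, Real.rpow_natCast]
    push_cast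
    ring
  hf_top := isBigO_theta_sub k
  hg_top := isBigO_dualTheta_sub k

variable {M c}

/-- For `k ≥ 1` the FE-pair of a coset is strong (no constant terms): weight `≥ 1` theta series are
cusp forms. [folklore] -/
theorem isStrongFEPair_cosetPair {k : ℕ} (hk : k ≠ 0) : IsStrongFEPair (cosetPair M c k) where
  hf₀ := by simp [cosetPair, theta₀, hk]
  hg₀ := by simp [cosetPair, dualTheta₀, hk]

variable (M c)

/-- **The continued coset zeta function with Grössencharakter `z^k`**:
`Z_k(s; c, M) = (π/M)^s Γ(s)⁻¹ Λ(s)`, `Λ` the completed Mellin transform of the FE-pair of the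
coset; for `Re s > k/2 + 1` it equals `∑_{z ≡ c (M), z ≠ 0} z^k N(z)^{-s}` (`hasSum_cosetZeta`).
[cite: HeckeMathZ1920, §9] -/
def cosetZeta (k : ℕ) (s : ℂ) : ℂ :=
  (((π / M : ℝ)) : ℂ) ^ s * (Complex.Gamma s)⁻¹ * (cosetPair M c k).Λ s

variable {M c}

/-- **`Z_k(·; c, M)` is entire for `k ≥ 1`.** [cite: HeckeMathZ1920, §9] -/
theorem differentiable_cosetZeta {k : ℕ} (hk : k ≠ 0) : Differentiable ℂ (cosetZeta M c k) := by
  have hπ : (((π / M : ℝ)) : ℂ) ≠ 0 := ofReal_ne_zero.mpr (div_pos pi_pos (M_pos M)).ne'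
  have hΛ : Differentiable ℂ (cosetPair M c k).Λ := (isStrongFEPair_cosetPair hk).differentiable_Λ
  intro s
  unfold cosetZeta
  exact ((differentiableAt_id.const_cpow (Or.inl hπ)).mul
    Complex.differentiable_one_div_Gamma.differentiableAt).mul (hΛ.differentiableAt)

/-- `Z_k(·; c, M)` is holomorphic at every `s ≠ 0, 1` (all `k`). [cite: HeckeMathZ1920, §9] -/
theorem differentiableAt_cosetZeta (k : ℕ) {s : ℂ} (hs0 : s ≠ 0) (hs1 : s ≠ 1) :
    DifferentiableAt ℂ (cosetZeta M c k) s := by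
  rcases Nat.eq_zero_or_pos k with rfl | hk
  · have hπ : (((π / M : ℝ)) : ℂ) ≠ 0 := ofReal_ne_zero.mpr (div_pos pi_pos (M_pos M)).ne'
    have hΛ : DifferentiableAt ℂ (cosetPair M c 0).Λ s := by
      refine (cosetPair M c 0).differentiableAt_Λ (Or.inl hs0) (Or.inl ?_)
      simp only [cosetPair, Nat.cast_zero, zero_add, ne_eq]
      exact_mod_cast hs1
    unfold cosetZeta
    exact ((differentiableAt_id.const_cpow (Or.inl hπ)).mul
      Complex.differentiable_one_div_Gamma.differentiableAt).mul hΛ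
  · exact (differentiable_cosetZeta hk.ne').differentiableAt

variable (M c)

/-- `H(s) = (π/M)^s Γ(s)⁻¹ ((s - 1) Λ₀(s) - (s - 1) Θ₀/s + M⁻¹)`: the function `(s - 1) Z_0(s; c, M)`
written through the entire `Λ₀` of the FE-pair (whose `Λ(s) = Λ₀(s) - Θ₀/s - M⁻¹/(1 - s)` for
`k = 0`). [folklore] -/
def cosetZetaH (s : ℂ) : ℂ :=
  (((π / M : ℝ)) : ℂ) ^ s * (Complex.Gamma s)⁻¹ *
    ((s - 1) * (cosetPair M c 0).Λ₀ s - (s - 1) * theta₀ M c 0 / s + ((M : ℂ))⁻¹)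

variable {M c}

/-- `H` is holomorphic at every `s ≠ 0`. [folklore] -/
theorem differentiableAt_cosetZetaH {s : ℂ} (hs0 : s ≠ 0) : DifferentiableAt ℂ (cosetZetaH M c) s := by
  have hπ : (((π / M : ℝ)) : ℂ) ≠ 0 := ofReal_ne_zero.mpr (div_pos pi_pos (M_pos M)).ne'
  have hΛ₀ := (cosetPair M c 0).differentiable_Λ₀.differentiableAt (x := s)
  unfold cosetZetaH
  refine ((differentiableAt_id.const_cpow (Or.inl hπ)).mul
    Complex.differentiable_one_div_Gamma.differentiableAt).mul ?_
  refine (((differentiableAt_id.sub_const 1).mul hΛ₀).sub ?_).add_const _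
  exact ((differentiableAt_id.sub_const 1).mul_const _).div differentiableAt_id hs0

/-- **`H(1) = π/M²`: the residue of `Z_0(s; c, M)` at `s = 1`** (the density `1/M²` of the coset
times the area factor `π`). [folklore] -/
theorem cosetZetaH_one : cosetZetaH M c 1 = π / (M : ℂ) ^ 2 := by
  have hM : (M : ℂ) ≠ 0 := by exact_mod_cast NeZero.ne M
  simp only [cosetZetaH, Complex.Gamma_one, inv_one, mul_one, sub_self, zero_mul, zero_div,
    zero_add, cpow_one]
  push_cast
  field_simp

/-- `H(s) = (s - 1) Z_0(s; c, M)` for `s ≠ 1`. [folklore] -/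
theorem cosetZetaH_eq {s : ℂ} (hs1 : s ≠ 1) : cosetZetaH M c s = (s - 1) * cosetZeta M c 0 s := by
  have h1s : (1 : ℂ) - s ≠ 0 := sub_ne_zero.mpr (Ne.symm hs1)
  have hk : (((cosetPair M c 0).k : ℝ) : ℂ) = 1 := by simp [cosetPair]
  have hf : (cosetPair M c 0).f₀ = theta₀ M c 0 := by simp [cosetPair]
  have hg : (cosetPair M c 0).g₀ = 1 := by simp [cosetPair, dualTheta₀]
  have hε : (cosetPair M c 0).ε = ((M : ℂ))⁻¹ := by simp [cosetPair]
  have hΛ : (cosetPair M c 0).Λ s = (cosetPair M c 0).Λ₀ s - theta₀ M c 0 / s - ((M : ℂ))⁻¹ / (1 - s) := by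
    rw [WeakFEPair.Λ, hk, hf, hg, hε, smul_eq_mul, smul_eq_mul, mul_one]
    ring
  have hkey : -(s - 1) / (1 - s) = (1 : ℂ) := by rw [neg_sub, div_self h1s]
  unfold cosetZetaH cosetZeta
  rw [hΛ]
  linear_combination (-(((π / M : ℝ) : ℂ)) ^ s * (Complex.Gamma s)⁻¹ * ((M : ℂ))⁻¹) * hkey

/-! ### The Dirichlet series for `Re s > k/2 + 1` -/

open scoped Classical in
/-- For `t > 0`: the theta series with the `z = 0` term removed, in the normalisation of
`hasSum_mellin_pi_mul₀` (`p y = N(c + My)/M`, `a y = (c + My)^k`). [folklore] -/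
theorem hasSum_thetaTerm_sub (k : ℕ) {t : ℝ} (ht : 0 < t) :
    HasSum (fun y : ℤ[i] ↦ if ((pt M c y).norm : ℝ) / M = 0 then 0
        else ((pt M c y : ℤ[i]) : ℂ) ^ k * rexp (-π * (((pt M c y).norm : ℝ) / M) * t))
      (theta M c k t - theta₀ M c k) := by
  have h1 : HasSum (fun y : ℤ[i] ↦ thetaTerm M c k t y - if pt M c y = 0 then thetaTerm M c k t y else 0)
      (theta M c k t - theta₀ M c k) := (hasSum_theta k ht).sub (hasSum_thetaTerm_zeroPart k t)
  refine h1.congr_fun fun y ↦ ?_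
  have hN : (((pt M c y).norm : ℝ) / M = 0) ↔ pt M c y = 0 := by
    rw [div_eq_zero_iff, or_iff_left (M_pos M).ne', Int.cast_eq_zero, GaussianInt.norm_eq_zero]
  by_cases hy : pt M c y = 0
  · rw [if_pos (hN.mpr hy), if_pos hy, sub_self]
  · rw [if_neg (hN.not.mpr hy), if_neg hy, sub_zero, thetaTerm]
    push_cast
    ring_nf

/-- `‖z^k‖ / (N(z)/M)^σ` is summable over the coset for `σ > k/2 + 1`. [folklore] -/
theorem summable_norm_pow_div_rpow (k : ℕ) {σ : ℝ} (hσ : (k : ℝ) / 2 + 1 < σ) :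
    Summable fun y : ℤ[i] ↦ ‖((pt M c y : ℤ[i]) : ℂ) ^ k‖ / (((pt M c y).norm : ℝ) / M) ^ σ := by
  have hM := M_pos M
  have h0 : Summable fun x : ℤ[i] ↦ ‖(x : ℂ) ^ k‖ / (x.norm : ℝ) ^ σ :=
    GaussianHecke.summable_norm_pow_div_rpow k hσ
  have h1 : Summable ((fun x : ℤ[i] ↦ ‖(x : ℂ) ^ k‖ / (x.norm : ℝ) ^ σ) ∘ pt M c) :=
    h0.comp_injective (pt_injective M c)
  refine (h1.mul_left ((M : ℝ) ^ σ)).congr fun y ↦ ?_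
  simp only [Function.comp_apply]
  have hN : (0 : ℝ) ≤ ((pt M c y).norm : ℝ) := by exact_mod_cast GaussianInt.norm_nonneg _
  rw [Real.div_rpow hN hM.le]
  field_simp

/-- **Mellin transform of `Θ_k - Θ₀`**: for `Re s > k/2 + 1`,
`∫₀^∞ (Θ_k(t; c, M) - Θ₀) t^{s-1} dt = π^{-s} Γ(s) ∑_{z ≡ c, z ≠ 0} z^k (N(z)/M)^{-s}`. [folklore] -/
theorem hasSum_mellin_theta_sub (k : ℕ) {s : ℂ} (hs : (k : ℝ) / 2 + 1 < s.re) :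
    HasSum (fun y : ℤ[i] ↦ (π : ℂ) ^ (-s) * Complex.Gamma s * ((pt M c y : ℤ[i]) : ℂ) ^ k /
        ((((pt M c y).norm : ℝ) / M : ℝ) : ℂ) ^ s)
      (mellin (fun t ↦ theta M c k t - theta₀ M c k) s) := by
  have hs0 : 0 < s.re := by
    have : (0 : ℝ) ≤ (k : ℝ) / 2 := by positivity
    linarith
  exact hasSum_mellin_pi_mul₀ (fun y ↦ div_nonneg (by exact_mod_cast GaussianInt.norm_nonneg _) (M_pos M).le)
    hs0 (fun t ht ↦ hasSum_thetaTerm_sub k ht) (summable_norm_pow_div_rpow k hs)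

/-- `Λ(s) = ∫₀^∞ (Θ_k(t; c, M) - Θ₀) t^{s-1} dt` whenever `Re s > k/2 + 1`. [folklore] -/
theorem cosetPair_Λ_eq_mellin (k : ℕ) {s : ℂ} (hs : (k : ℝ) / 2 + 1 < s.re) :
    (cosetPair M c k).Λ s = mellin (fun t ↦ theta M c k t - theta₀ M c k) s := by
  rcases Nat.eq_zero_or_pos k with rfl | hk
  · have hk1 : (cosetPair M c 0).k < s.re := by
      show ((0 : ℕ) : ℝ) + 1 < s.re
      norm_num at hs ⊢
      exact hs
    exact ((cosetPair M c 0).hasMellin hk1).2.symm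
  · have hS := isStrongFEPair_cosetPair (M := M) (c := c) hk.ne'
    have h0 : theta₀ M c k = 0 := by simp [theta₀, hk.ne']
    simp only [h0, sub_zero]
    have := (hS.hasMellin s).2.symm
    simpa [cosetPair] using this

/-- `((N/M : ℝ) : ℂ)^s = (N : ℂ)^s / ((M : ℝ) : ℂ)^s` for `N ≥ 0`. [folklore] -/
theorem ofReal_div_cpow {a : ℝ} (ha : 0 ≤ a) (s : ℂ) :
    (((a / M : ℝ)) : ℂ) ^ s = ((a : ℝ) : ℂ) ^ s / (((M : ℝ)) : ℂ) ^ s := by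
  have hM := M_pos M
  rw [div_eq_mul_inv, ofReal_mul, Complex.mul_cpow_ofReal_nonneg ha (inv_nonneg.mpr hM.le),
    ofReal_inv, Complex.inv_cpow _ _ ?_, div_eq_mul_inv]
  rw [Complex.arg_ofReal_of_nonneg (Nat.cast_nonneg M)]
  exact pi_ne_zero.symm

/-- **`Z_k(s; c, M) = ∑_{z ≡ c (mod M), z ≠ 0} z^k N(z)^{-s}` for `Re s > k/2 + 1`** (absolutely
convergent). [cite: HeckeMathZ1920, §9] -/
theorem hasSum_cosetZeta (k : ℕ) {s : ℂ} (hs : (k : ℝ) / 2 + 1 < s.re) :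
    HasSum (fun y : ℤ[i] ↦ if pt M c y = 0 then 0 else
      ((pt M c y : ℤ[i]) : ℂ) ^ k / ((((pt M c y).norm : ℝ)) : ℂ) ^ s) (cosetZeta M c k s) := by
  have hM := M_pos M
  have hs0 : 0 < s.re := by
    have : (0 : ℝ) ≤ (k : ℝ) / 2 := by positivity
    linarith
  have hsne : s ≠ 0 := fun h ↦ by rw [h, zero_re] at hs0; exact lt_irrefl _ hs0
  have hπM : (((π / M : ℝ)) : ℂ) ≠ 0 := ofReal_ne_zero.mpr (div_pos pi_pos hM).ne'
  have hπMs : (((π / M : ℝ)) : ℂ) ^ s ≠ 0 := by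
    rw [Ne, cpow_eq_zero_iff]; exact fun h ↦ hπM h.1
  have hΓ : Complex.Gamma s ≠ 0 := Complex.Gamma_ne_zero_of_re_pos hs0
  have hMc : (((M : ℝ)) : ℂ) ^ s ≠ 0 := by
    rw [Ne, cpow_eq_zero_iff]; exact fun h ↦ (ofReal_ne_zero.mpr hM.ne') h.1
  have h := hasSum_mellin_theta_sub (M := M) (c := c) k hs
  rw [← cosetPair_Λ_eq_mellin k hs] at h
  have h2 := h.mul_left ((((π / M : ℝ)) : ℂ) ^ s * (Complex.Gamma s)⁻¹)
  refine h2.congr_fun fun y ↦ ?_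
  -- termwise algebra
  have hπ' : (((π / M : ℝ)) : ℂ) ^ s = (π : ℂ) ^ s / (((M : ℝ)) : ℂ) ^ s := ofReal_div_cpow pi_pos.le s
  have hN0 : (0 : ℝ) ≤ ((pt M c y).norm : ℝ) := by exact_mod_cast GaussianInt.norm_nonneg _
  rw [ofReal_div_cpow hN0 s]
  by_cases hy : pt M c y = 0
  · rw [if_pos hy, hy]
    simp [Complex.zero_cpow hsne]
  · rw [if_neg hy, hπ', cpow_neg]
    have hπs : (π : ℂ) ^ s ≠ 0 := by
      rw [Ne, cpow_eq_zero_iff]; exact fun h ↦ (ofReal_ne_zero.mpr pi_pos.ne') h.1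
    field_simp

end GaussianCosetTheta

end Literature.NumberTheory.LFunctions
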